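import Summits.BirchSwinnertonDyer.BirchSwinnertonDyer.Theorems.GenusKolyvaginAtTwoPowDvdShaCardAtTwoRTLocalKernelHeegnerUnramified
import Literature.NumberTheory.EllipticCurves.SelmerTorsionRestriction
import HarnessLib

/-!
# Route `GenusKolyvaginAtTwo`, LINE 18 / LINE 19 (L_T stmt-BirchSwinnertonDyer-23242, L⁺_T stmt-23379), critic idea-crit-5
# VERDICT #179 «genus budget» AS A THEOREM: the Selmer group of `E/ℚ` RELAXED at the primes of `d_K` to the `K`-local
# conditions contains `Sel^(n)(E/ℚ)` with index `≤ ∏_{p ∣ d_K} #E(ℚ_p)[2] = 2^{Σ_{p ∣ d_K} i_p}`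

Seat `bsd-line-gk2-p3` g17 (cell `bsd-f1-sign2`), `--supports stmt-BirchSwinnertonDyer-23242` (helper; closes nothing).
THEOREMS ONLY (no definition, no named fact, no `sorry`); BSD is not proved by any of this.

SETTING.  `E/ℚ` elliptic, `K` a quadratic field with odd discriminant `d_K` such that `E` has good reduction at every prime
`p ∤ d_K` that does not split in `K` (for the Heegner field of the GK2 habitat: every `p ∣ N` splits, Heegner hypothesis), and
a level `n`.  The `d_K`-RELAXED SELMER GROUP of the (+)-descent is the group of classes `x ∈ H¹(ℚ, E[n])` whose restriction
`res x ∈ H¹(K, E[n])` is Selmer for `E_K` and which satisfy the archimedean condition over `ℚ`: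
`Sel^rel := res⁻¹(Sel^(n)(E_K/K)) ⊓ ⨅_∞ (local condition at ℝ)` — no new definition, an expression in the tree's
`selmerGroup`, `resTorsion`, `selmerLocalKer`.  At a finite place `v` of `ℚ` the condition `res x ∈ Sel(E_K)` reads «`x` dies in
`H¹(K_w, E)` for the `w ∣ v`» (`mem_selmerLocalKer_adicCompletion_of_resTorsion_mem`); by the local dictionary of this lineage
that IS the `ℚ_v`-condition at every `v ∤ d_K` (split: `[K_w : ℚ_v] = 1`; non-split: unramified of good reduction, Milne I.3.8 —
`selmerLocalKer_adicCompletion_eq_of_not_dvd_discr_of_imp`), and at `p ∣ d_K` it exceeds the `ℚ_p`-condition by at most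
`#W_{p,K} ≤ #E(ℚ_p)[2]` (`relIndex_selmerLocalKer_le_natCard_twoTorsion_of_dvd_discr`).  MAIN THEOREM
`relIndex_selmerGroup_relaxed_le_prod_natCard_twoTorsion`:

  `[Sel^rel : Sel^(n)(E/ℚ)] ≤ ∏_{p ∣ d_K} #E(ℚ_p)[2]`  (and `Sel^(n)(E/ℚ) ≤ Sel^rel`, `selmerGroup_le_relaxed`).

With `#E(ℚ_p)[2] = #Ẽ(𝔽_p)[2] = 2^{i_p}` (`…RTLocalKernelOneBitPadic`) this is the genus budget `2^{Σ_{p ∣ d_K} i_p}` of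
critic #179 / the pen's instrument law `e_an = Σ_{v ∣ d_K∞} i_v − 1` (finite part), for every level `n` and with no
hypothesis on `E` at the primes of `d_K`.  Bookkeeping: `relIndex_inf_iInf_le_prod` / `relIndex_inf_iInf_ne_zero`.

References: [Kramer1981] §2 Prop. 3, Thm. 1; [MazurRubin2010] Prop. 3.3 (local conditions at T-primes);
[DokchitserDokchitserAnnals2010] Lemma 4.14 (proof); [MilneADT2006] I Prop. 3.8; [Matsuno2009] §3, Prop. 3.2.
-/

set_option autoImplicit false
-- the Theorems namespace of this sub repeats the summit name by design (D-0017 nested layout)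
set_option linter.dupNamespace false

noncomputable section

open scoped Classical

namespace Summit.BirchSwinnertonDyer.BirchSwinnertonDyer.Theorems.GenusExact.PlusDescent

open WeierstrassCurve NumberField IsDedekindDomain Rat.HeightOneSpectrum Literature.NumberTheory.EllipticCurves
  Literature.Barriers.BirchSwinnertonDyer

/-! ## §1 Bookkeeping -/

section Abstract

variable {A : Type*} [AddCommGroup A]

/-- `[C ⊓ ⨅ H i : C ⊓ ⨅ H' i]` is FINITE (non-zero) when every `[H i : H' i ∩ H i]` is (`i ∈ ι` finite): companion of
`relIndex_inf_iInf_le_prod` (Mathlib `relIndex_iInf_ne_zero`, `relIndex_eq_zero_of_le_right`). [folklore] -/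
theorem relIndex_inf_iInf_ne_zero {ι : Type*} [Finite ι] (C : AddSubgroup A) (H' H : ι → AddSubgroup A)
    (hfin : ∀ i, (H' i).relIndex (H i) ≠ 0) :
    (C ⊓ ⨅ i, H' i).relIndex (C ⊓ ⨅ i, H i) ≠ 0 := by
  set L : AddSubgroup A := C ⊓ ⨅ i, H i with hL
  have hLC : L ≤ C := inf_le_left
  have hLH : ∀ i, L ≤ H i := fun i ↦ inf_le_right.trans (iInf_le _ i)
  have h1 : (C ⊓ ⨅ i, H' i).relIndex L = (⨅ i, H' i).relIndex L := by
    rw [← AddSubgroup.inf_relIndex_right (C ⊓ ⨅ i, H' i), ← AddSubgroup.inf_relIndex_right (⨅ i, H' i)]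
    congr 1
    apply le_antisymm
    · exact le_inf (inf_le_left.trans inf_le_right) inf_le_right
    · exact le_inf (le_inf (inf_le_right.trans hLC) inf_le_left) inf_le_right
  rw [h1]
  exact AddSubgroup.relIndex_iInf_ne_zero fun i h0 ↦ hfin i
    (by
      by_contra hne
      exact hne (AddSubgroup.relIndex_eq_zero_of_le_right (hLH i) h0 ▸ rfl) |>.elim)

end Abstract

/-! ## §2 Places of `ℚ`: `primePlace (p_v) = v`; the `K`-local condition of a class with Selmer restriction -/

section Places

/-- `Matsuno2009.primePlace` inverts Mathlib's `primesEquiv`: the place at the prime under `v` is `v`. [folklore] -/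
theorem primePlace_primesEquiv (v : HeightOneSpectrum (𝓞 ℚ)) :
    Matsuno2009.primePlace (primesEquiv v : ℕ) = v := by
  unfold Matsuno2009.primePlace
  rw [dif_pos (primesEquiv v).2, Subtype.coe_eta, Equiv.symm_apply_apply]

variable (E : WeierstrassCurve ℚ) (K : Type) [Field K] [NumberField K] (n : ℤ)

/-- **The `K`-local condition of a class whose restriction is Selmer**: if `res x ∈ Sel^(n)(E_K/K)` for
`x ∈ H¹(ℚ, E[n])`, then at every finite place `w ∣ v` of `K` the class `x` satisfies the `K_w`-local condition
(`x ∈ selmerLocalKer E K_w n`): restriction commutes with `H¹(·, E[n]) → H¹(·, E)` (`torsionH1ToH1_resTorsion`), `Sel` is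
the preimage of `Ш` (`selmerGroup_eq_comap_sha`), and local conditions correspond under restriction
(`mem_localRestrictionKer_iff_resBaseChange_mem`). [cite: MilneADT2006, Ch. I §6] [cite: SilvermanAEC2009, X.§4] -/
theorem mem_selmerLocalKer_adicCompletion_of_resTorsion_mem {x : galH1Torsion E n}
    (hx : resTorsion E K n x ∈ selmerGroup (E.baseChange K) n) (v : HeightOneSpectrum (𝓞 ℚ))
    (w : HeightOneSpectrum (𝓞 K)) [w.asIdeal.LiesOver v.asIdeal] :
    x ∈ selmerLocalKer E (w.adicCompletion K) n := by
  haveI : IsScalarTower ℚ K (w.adicCompletion K) := IsScalarTower.of_algebraMap_eq fun y ↦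
    (IsScalarTower.algebraMap_apply ℚ K (w.adicCompletion K) y)
  rw [selmerGroup_eq_comap_sha, AddSubgroup.mem_comap, torsionH1ToH1_resTorsion, WeierstrassCurve.mem_sha_iff] at hx
  rw [WeierstrassCurve.mem_selmerLocalKer_iff_torsionH1ToH1_mem]
  exact (mem_localRestrictionKer_iff_resBaseChange_mem E (L := K) (E' := w.adicCompletion K) _).mpr (hx.1 w)

variable {K} in
/-- **Off `d_K` the `K_w`-condition is the `ℚ_p`-condition** (both cases of this lineage's dictionary at once): `[K : ℚ] = 2`,
`Odd d_K`, `p ∤ d_K`, and `E` has good reduction at `p` unless `p` splits in `K`; then for `w ∣ p` and every level `n`,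
`selmerLocalKer E K_w n = selmerLocalKer E ℚ_p n` (`…_of_ncard_primesOver_eq_two` at split `p`,
`…_of_not_dvd_discr` at non-split, hence unramified good, `p`). [cite: MilneADT2006, Ch. I Prop. 3.8]
[cite: DokchitserDokchitserAnnals2010, Lemma 4.14 (proof)] -/
theorem selmerLocalKer_adicCompletion_eq_of_not_dvd_discr_of_imp [E.IsElliptic] (h2 : Module.finrank ℚ K = 2)
    (hodd : Odd (NumberField.discr K)) {p : ℕ} (hp : p.Prime) (hpd : ¬ (p : ℤ) ∣ NumberField.discr K)
    (hgood : ((Ideal.span {(p : ℤ)}).primesOver (𝓞 K)).ncard ≠ 2 → E.HasGoodReductionAt (Matsuno2009.primePlace p))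
    (w : HeightOneSpectrum (𝓞 K)) [w.asIdeal.LiesOver (Matsuno2009.primePlace p).asIdeal] :
    selmerLocalKer E (w.adicCompletion K) n = selmerLocalKer E ((Matsuno2009.primePlace p).adicCompletion ℚ) n := by
  by_cases hsplit : ((Ideal.span {(p : ℤ)}).primesOver (𝓞 K)).ncard = 2
  · exact selmerLocalKer_adicCompletion_eq_of_ncard_primesOver_eq_two E K w h2 hp hsplit n
  · exact selmerLocalKer_adicCompletion_eq_of_not_dvd_discr E K w h2 hodd hp hpd (hgood hsplit) n

end Places

/-! ## §3 The genus budget -/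

section Budget

variable (E : WeierstrassCurve ℚ) [E.IsElliptic] (K : Type) [Field K] [NumberField K] (n : ℤ)

omit [E.IsElliptic] in
/-- `Sel^(n)(E/ℚ)` lies in the `d_K`-relaxed Selmer group `res⁻¹(Sel^(n)(E_K/K)) ⊓ (archimedean condition)`
(`resTorsion_mem_selmerGroup`). [cite: MilneADT2006, Ch. I §6] -/
theorem selmerGroup_le_relaxed :
    selmerGroup E n ≤ (selmerGroup (E.baseChange K) n).comap (resTorsion E K n) ⊓
      ⨅ w : InfinitePlace ℚ, selmerLocalKer E w.Completion n := by
  intro x hx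
  refine ⟨AddSubgroup.mem_comap.mpr (resTorsion_mem_selmerGroup E K n hx), ?_⟩
  exact (AddSubgroup.mem_inf.mp hx).2

/-- **THE GENUS BUDGET (critic #179) AS A THEOREM.**  Let `E/ℚ` be an elliptic curve, `K` a quadratic field with odd
discriminant `d_K` such that `E` has good reduction at every prime `p ∤ d_K` that does not split in `K` (e.g. the Heegner
field of the GK2 habitat: every prime of bad reduction splits), and `n` a level.  Then the `d_K`-RELAXED Selmer group
`Sel^rel = res⁻¹(Sel^(n)(E_K/K)) ⊓ ⨅_∞(local condition at ℝ)` — the classes of `H¹(ℚ, E[n])` that are Selmer after restriction to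
`K` and satisfy the real condition — contains `Sel^(n)(E/ℚ)` (`selmerGroup_le_relaxed`) with index

  `[Sel^rel : Sel^(n)(E/ℚ)] ≤ ∏_{p ∣ d_K} #E(ℚ_p)[2]` (`= 2^{Σ_{p ∣ d_K} i_p}`, `i_p = dim Ẽ(𝔽_p)[2]`).

Proof: `Sel^rel ⊆ C ⊓ ⨅_{p ∣ d_K} (K_{w_p}-condition)` and `C ⊓ ⨅_{p ∣ d_K} (ℚ_p-condition) ⊆ Sel`, where `C` collects the
`ℚ_v`-conditions at `v ∤ d_K` and at `∞` (off `d_K` the `K_w`- and `ℚ_v`-conditions agree,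
`selmerLocalKer_adicCompletion_eq_of_not_dvd_discr_of_imp`); then `relIndex_inf_iInf_le_prod` and the one-bit bound at each
`p ∣ d_K` (`relIndex_selmerLocalKer_le_natCard_twoTorsion_of_dvd_discr`).  Kramer 1981 (local norm indices `i_p` at the primes
of `d_K`); Mazur–Rubin 2010 Prop. 3.3 (Selmer conditions relaxed at T-primes). [cite: Kramer1981, §2 Prop. 3 and Thm. 1]
[cite: MazurRubin2010, Prop. 3.3] [cite: DokchitserDokchitserAnnals2010, Lemma 4.14 (proof)] -/
theorem relIndex_selmerGroup_relaxed_le_prod_natCard_twoTorsion (h2 : Module.finrank ℚ K = 2)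
    (hodd : Odd (NumberField.discr K))
    (hgood : ∀ p : ℕ, p.Prime → ¬ (p : ℤ) ∣ NumberField.discr K →
      ((Ideal.span {(p : ℤ)}).primesOver (𝓞 K)).ncard ≠ 2 → E.HasGoodReductionAt (Matsuno2009.primePlace p)) :
    (selmerGroup E n).relIndex ((selmerGroup (E.baseChange K) n).comap (resTorsion E K n) ⊓
        ⨅ w : InfinitePlace ℚ, selmerLocalKer E w.Completion n) ≤
      ∏ p ∈ (NumberField.discr K).natAbs.primeFactors,
        Nat.card {P : (E.baseChange ((Matsuno2009.primePlace p).adicCompletion ℚ)).toAffine.Point // 2 • P = 0} := by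
  set D : Finset ℕ := (NumberField.discr K).natAbs.primeFactors with hDdef
  have hD0 : (NumberField.discr K).natAbs ≠ 0 := Int.natAbs_ne_zero.mpr (NumberField.discr_ne_zero K)
  have hmemD : ∀ {p : ℕ}, p ∈ D ↔ p.Prime ∧ (p : ℤ) ∣ NumberField.discr K := by
    intro p
    rw [hDdef, Nat.mem_primeFactors, Int.natCast_dvd]
    exact ⟨fun h ↦ ⟨h.1, h.2.1⟩, fun h ↦ ⟨h.1, h.2, hD0⟩⟩
  have hDodd : ∀ p : D, (p : ℕ) ≠ 2 := by
    rintro ⟨p, hp⟩ (h2' : p = 2)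
    obtain ⟨-, hpd⟩ := hmemD.mp hp
    rw [h2'] at hpd
    obtain ⟨r, hr⟩ := hodd
    omega
  -- a place `w_p ∣ p` of `K` for each `p ∣ d_K`, and one above every place of `ℚ`
  have hexw : ∀ v : HeightOneSpectrum (𝓞 ℚ), ∃ w : HeightOneSpectrum (𝓞 K), w.asIdeal.LiesOver v.asIdeal := by
    intro v
    haveI := v.isMaximal
    obtain ⟨P, hPm, hP⟩ := Ideal.exists_maximal_ideal_liesOver_of_isIntegral (S := 𝓞 K) v.asIdeal
    exact ⟨⟨P, hPm.isPrime, Ideal.ne_bot_of_liesOver_of_ne_bot v.ne_bot P⟩, hP⟩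
  choose wv hwv using hexw
  let wp : D → HeightOneSpectrum (𝓞 K) := fun p ↦ wv (Matsuno2009.primePlace p)
  have hwp : ∀ p : D, (wp p).asIdeal.LiesOver (Matsuno2009.primePlace (p : ℕ)).asIdeal := fun p ↦ hwv _
  -- the local conditions
  let H' : HeightOneSpectrum (𝓞 ℚ) → AddSubgroup (galH1Torsion E n) := fun v ↦ selmerLocalKer E (v.adicCompletion ℚ) n
  let Hs : D → AddSubgroup (galH1Torsion E n) := fun p ↦ selmerLocalKer E ((wp p).adicCompletion K) n
  let H's : D → AddSubgroup (galH1Torsion E n) := fun p ↦ H' (Matsuno2009.primePlace p)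
  let Ainf : AddSubgroup (galH1Torsion E n) := ⨅ w : InfinitePlace ℚ, selmerLocalKer E w.Completion n
  let C : AddSubgroup (galH1Torsion E n) :=
    (⨅ v : {v : HeightOneSpectrum (𝓞 ℚ) // (primesEquiv v : ℕ) ∉ D}, H' v) ⊓ Ainf
  set R : AddSubgroup (galH1Torsion E n) :=
    (selmerGroup (E.baseChange K) n).comap (resTorsion E K n) ⊓ Ainf with hRdef
  -- (a) `C ⊓ ⨅ H's ≤ Sel`
  have hS₀ : C ⊓ (⨅ p : D, H's p) ≤ selmerGroup E n := by
    intro x hx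
    obtain ⟨⟨hxC, hxinf⟩, hxD⟩ := AddSubgroup.mem_inf.mp hx |>.imp AddSubgroup.mem_inf.mp id
    refine AddSubgroup.mem_inf.mpr ⟨AddSubgroup.mem_iInf.mpr fun v ↦ ?_, hxinf⟩
    by_cases hv : (primesEquiv v : ℕ) ∈ D
    · have h := AddSubgroup.mem_iInf.mp hxD ⟨_, hv⟩
      change x ∈ selmerLocalKer E ((Matsuno2009.primePlace (primesEquiv v : ℕ)).adicCompletion ℚ) n at h
      rwa [primePlace_primesEquiv] at h
    · exact AddSubgroup.mem_iInf.mp hxC ⟨v, hv⟩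
  -- (b) `R ≤ C ⊓ ⨅ Hs`
  have hR : R ≤ C ⊓ (⨅ p : D, Hs p) := by
    intro x hx
    obtain ⟨hxK, hxinf⟩ := AddSubgroup.mem_inf.mp hx
    rw [AddSubgroup.mem_comap] at hxK
    refine AddSubgroup.mem_inf.mpr ⟨AddSubgroup.mem_inf.mpr ⟨AddSubgroup.mem_iInf.mpr fun v ↦ ?_, hxinf⟩,
      AddSubgroup.mem_iInf.mpr fun p ↦ ?_⟩
    · -- off `d_K`: the `K_w`-condition (from `res x ∈ Sel(E_K)`) is the `ℚ_v`-condition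
      obtain ⟨v, hv⟩ := v
      set p : ℕ := (primesEquiv v : ℕ) with hpdef
      have hp : p.Prime := (primesEquiv v).2
      have hpd : ¬ (p : ℤ) ∣ NumberField.discr K := fun h ↦ hv (hmemD.mpr ⟨hp, h⟩)
      change x ∈ selmerLocalKer E (v.adicCompletion ℚ) n
      rw [← primePlace_primesEquiv v]
      haveI := hwv (Matsuno2009.primePlace p)
      rw [← selmerLocalKer_adicCompletion_eq_of_not_dvd_discr_of_imp E n h2 hodd hp hpd (hgood p hp hpd)
        (wv (Matsuno2009.primePlace p))]
      exact mem_selmerLocalKer_adicCompletion_of_resTorsion_mem E K n hxK (Matsuno2009.primePlace p)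
        (wv (Matsuno2009.primePlace p))
    · haveI := hwp p
      exact mem_selmerLocalKer_adicCompletion_of_resTorsion_mem E K n hxK (Matsuno2009.primePlace (p : ℕ)) (wp p)
  -- (c) the indices at `p ∣ d_K`
  have hdeg : ∀ p : D,
      letI : Algebra ((Matsuno2009.primePlace (p : ℕ)).adicCompletion ℚ) ((wp p).adicCompletion K) :=
        (Literature.NumberTheory.EllipticCurves.adicCompletionMap (K := ℚ) K (Matsuno2009.primePlace (p : ℕ)) (wp p)).toAlgebra
      Module.finrank ((Matsuno2009.primePlace (p : ℕ)).adicCompletion ℚ) ((wp p).adicCompletion K) = 2 := by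
    intro p
    haveI := hwp p
    obtain ⟨hp, hpd⟩ := hmemD.mp p.2
    exact finrank_adicCompletion_primePlace_eq_two_of_dvd_discr (wp p) h2 hp (hDodd p) hpd
  have hfin : ∀ p : D, (H's p).relIndex (Hs p) ≠ 0 := by
    intro p
    haveI := hwp p
    haveI := Fact.mk (hmemD.mp p.2).1
    exact relIndex_selmerLocalKer_ne_zero E K (Matsuno2009.primePlace (p : ℕ)) (wp p) (hdeg p)
      (two_not_mem_of_liesOver_primePlace K (wp p) (hDodd p)) n
  have hbd : ∀ p : D, (H's p).relIndex (Hs p) ≤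
      Nat.card {P : (E.baseChange ((Matsuno2009.primePlace (p : ℕ)).adicCompletion ℚ)).toAffine.Point // 2 • P = 0} := by
    intro p
    haveI := hwp p
    obtain ⟨hp, hpd⟩ := hmemD.mp p.2
    exact relIndex_selmerLocalKer_le_natCard_twoTorsion_of_dvd_discr K (wp p) E h2 hp (hDodd p) hpd n
  -- (d) assembly
  have hne : (C ⊓ ⨅ p : D, H's p).relIndex (C ⊓ ⨅ p : D, Hs p) ≠ 0 := relIndex_inf_iInf_ne_zero C H's Hs hfin
  have hne' : (selmerGroup E n).relIndex (C ⊓ ⨅ p : D, Hs p) ≠ 0 :=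
    ne_zero_of_dvd_ne_zero hne (AddSubgroup.relIndex_dvd_of_le_left _ hS₀)
  calc (selmerGroup E n).relIndex R
      ≤ (selmerGroup E n).relIndex (C ⊓ ⨅ p : D, Hs p) := AddSubgroup.relIndex_le_of_le_right hR hne'
    _ ≤ (C ⊓ ⨅ p : D, H's p).relIndex (C ⊓ ⨅ p : D, Hs p) := AddSubgroup.relIndex_le_of_le_left hS₀ hne
    _ ≤ ∏ p : D, (H's p).relIndex (Hs p) := relIndex_inf_iInf_le_prod C H's Hs hfin
    _ ≤ ∏ p : D, Nat.card {P : (E.baseChange ((Matsuno2009.primePlace (p : ℕ)).adicCompletion ℚ)).toAffine.Point //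
          2 • P = 0} := Finset.prod_le_prod' fun p _ ↦ hbd p
    _ = ∏ p ∈ D, Nat.card {P : (E.baseChange ((Matsuno2009.primePlace p).adicCompletion ℚ)).toAffine.Point //
          2 • P = 0} :=
        Finset.prod_coe_sort D (f := fun p : ℕ ↦
          Nat.card {P : (E.baseChange ((Matsuno2009.primePlace p).adicCompletion ℚ)).toAffine.Point // 2 • P = 0})

end Budget

end Summit.BirchSwinnertonDyer.BirchSwinnertonDyer.Theorems.GenusExact.PlusDescent

end
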